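import Summits.CriticalPhenomena.PercolationContinuityZ3.Theorems.Transplant.SkelNegBParamsFaceCountsRangeA
import Summits.CriticalPhenomena.PercolationContinuityZ3.Theorems.Transplant.SkelNegBParamsFaceRunA
import Summits.CriticalPhenomena.PercolationContinuityZ3.Theorems.Transplant.SkelPhiFaceNumsYRun
import HarnessLib

/-!
# N1 params, M3 group G-clr (x-face) — **THE SEED CLEARANCES OF AN x-FACE AT THE (ζ′) TUPLE**: the fields `hclr` (along x-run, α-floor) and
# `hclr₃` (tangential y′-run, per region the α-floor OR the level floor) of `Skelφ.FloorsX2` (SkelPhiFaceNumsXP2 :88–:94) at M3-FLOORS-SIGNATURE §1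
(p1-g14, 2026-08-22; lead g8 07:03:26Z 'p1 lineage = G-clr'; statements pinned by p3-g12's `FaceFloorsXA.skeleton.lean` — conclusions byte-identical,
premise block trimmed to what the proofs use).

* **`hclr_XA`** — `M_u < xBoxLoA n_L qB RA′ k + σ·yL 0` for every `k ≤ NrX`, from the ONE origin floor `hyL : M_u < σ·yL 0 − qB − RA′ − n_L` (the
  `k = 0` instance; RootCases' `hclr_s` shape with `D.k ↦ M_u`, served per bridge case by G-O as FaceRun's `hclrX_s/d/t` are at the root pair) and
  `RA′ ≤ n_L` (monotonicity in `k`, `xBoxLoA_mono`).  This is the group's only added hypothesis.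
* **`hclr₃_XA`** — NO added hypothesis: for `k ≤ 30` the α-branch (the tangential run starts `(NrX+1)·n_L ≥ (200·Kq − 7)·n_L` beyond the cross-shifted
  origin, itself within `15·n_L` of the contact by the two origin readings `|FcA(yTX0 yL σT)| ≤ 6u₀`, `|F1cA yL| ≤ 6u₁`; region `k`'s transverse range is
  within `(k+3)·n_L + (k+1)·RA′`), for `k ≥ 31` the level branch (region `k` sits `≥ k·(n_Lℓ_L − 2U) − 4n_Lℓ_L − …` above the origin's level
  `|n_L·yT 1 − h_L·yT 0| ≤ 7m + n_L`, against the seed's level extent `U·M_u ≤ 11·n_L·RA′`).  The split point is immaterial (both branches hold for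
  `13 ≤ k ≤ 170`); the α-only form would compare `NrX` with `N3X` (located (L-F5), p5-g10 2026-08-22T01:02Z) and is NOT used.
Generic arithmetic (`§1`) is chain-free; `§2` reads the origin (`|Λ₀|, |Λ₁| ≤ 7m` from the fine readings, `m·y 0 = n_L·Λ₀(y) + v_L·Λ₁(y)`); `§3` the two fields.
builds on p205010 (kernel theorem, internal audit signed; external expert review pending) — nothing in this file uses p205010; NOTHING is claimed about the node
`SamePDropOfSkeletonNeg₁` (OPEN); integer arithmetic only.
Lane `prim-bschramm-*`, seat `prim-bschramm-p1` (gen 14); helper file (`--supports stmt-CriticalPhenomena-4575 --as helper`); slot-ledger ζ′ v1.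
[cite: KozmaNitzan2024, §4 Lemma 11 (pp. 22–23), Lemma 12 (pp. 23–25)] [cite: MartineauTassion2017, §4.1, §4.3 Lemma 4.2]
-/

noncomputable section

open scoped Classical

namespace Summit.CriticalPhenomena.PercolationContinuityZ3.Theorems.Transplant

namespace PlanarSkeletonNeg

namespace NegB

open Literature.Probability.Percolation Literature.Probability.LatticeModels SimpleGraph
open Literature.Probability.Percolation.KozmaNitzan.Cells (oth sgOf sgOf_sign)
open SkelConc (Consts)
open Skelφ (shearUnit shearUnit_pos xBoxLoA yBoxLoT yBoxHiT yBoxLoS crossOffX)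
open Skelφ.StepI (DataN)
open TwoAxis.Para (modulus)
open Neg

namespace KS

/-! ## §1 Generic arithmetic (chain-free) -/

section Arith

/-- **`hclr` from its `k = 0` instance**: `M < −(qB + R + n) + a` and `R ≤ n` give `M < xBoxLoA n qB R k + a` for every `k`. [folklore] -/
theorem clr_hclrX_of_zero {n qB R : ℕ} (hR : R ≤ n) {M a : ℤ} (h0 : M < -((qB : ℤ) + R + n) + a) (k : ℕ) : M < xBoxLoA n qB R k + a := by
  have hmono := xBoxLoA_mono (q := qB) hR k
  have e0 : xBoxLoA n qB R 0 = -((qB : ℤ) + R + n) := by unfold Skelφ.xBoxLoA; push_cast; ring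
  rw [e0] at hmono
  linarith

/-- **The transverse range of region `k` of a y′-run is within `(k+3)·n + (k+1)·R` of its origin** (either sign `σT`, `|v| ≤ n`). [folklore] -/
theorem clr_yBoxT_range {n : ℕ} {v : ℤ} (hv : |v| ≤ n) (R k : ℕ) {σT : ℤ} (hσT : σT = 1 ∨ σT = -1) {b : ℤ}
    (h1 : min (σT * yBoxLoT n v R k) (σT * yBoxHiT n v R k) ≤ b) (h2 : b ≤ max (σT * yBoxLoT n v R k) (σT * yBoxHiT n v R k)) :
    |b| ≤ ((k : ℤ) + 3) * n + ((k : ℤ) + 1) * R := by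
  obtain ⟨hv1, hv2⟩ := abs_le.1 hv
  have hk : (0 : ℤ) ≤ k := Nat.cast_nonneg _
  have hR : (0 : ℤ) ≤ R := Nat.cast_nonneg _
  have e1 : ((((n : ℤ) + v).toNat : ℕ) : ℤ) = n + v := Int.toNat_of_nonneg (by linarith)
  have e2 : ((((n : ℤ) - v).toNat : ℕ) : ℤ) = n - v := Int.toNat_of_nonneg (by linarith)
  have hkv1 : (k : ℤ) * (-(n : ℤ)) ≤ (k : ℤ) * v := mul_le_mul_of_nonneg_left hv1 hk
  have hkv2 : (k : ℤ) * v ≤ (k : ℤ) * n := mul_le_mul_of_nonneg_left hv2 hk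
  set X : ℤ := ((k : ℤ) + 3) * n + ((k : ℤ) + 1) * R with hX
  have hLo : -X ≤ yBoxLoT n v R k ∧ yBoxLoT n v R k ≤ X := by
    unfold Skelφ.yBoxLoT; rw [e1, hX]; constructor <;> nlinarith
  have hHi : -X ≤ yBoxHiT n v R k ∧ yBoxHiT n v R k ≤ X := by
    unfold Skelφ.yBoxHiT; rw [e2, hX]; constructor <;> nlinarith
  have hA : -X ≤ σT * yBoxLoT n v R k ∧ σT * yBoxLoT n v R k ≤ X := by
    rcases hσT with rfl | rfl <;> constructor <;> linarith [hLo.1, hLo.2]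
  have hB : -X ≤ σT * yBoxHiT n v R k ∧ σT * yBoxHiT n v R k ≤ X := by
    rcases hσT with rfl | rfl <;> constructor <;> linarith [hHi.1, hHi.2]
  rw [min_le_iff] at h1
  rw [le_max_iff] at h2
  rw [abs_le]
  rcases h1 with h1 | h1 <;> rcases h2 with h2 | h2 <;> constructor <;> linarith [hA.1, hA.2, hB.1, hB.2]

/-- **The α-branch of `hclr₃`, generic**: if the run origin's signed abscissa exceeds `(k+3)·n + (k+1)·R + M`, region `k`'s whole transverse range
clears the seed box `M`. [cite: KozmaNitzan2024, §4 Lemma 12 (pp. 23–25)] -/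
theorem clr_tan_alpha_of_room {n : ℕ} {v : ℤ} (hv : |v| ≤ n) (R k : ℕ) {σ σT : ℤ} (hσ : σ = 1 ∨ σ = -1) (hσT : σT = 1 ∨ σT = -1)
    {M y0 : ℤ} (hroom : ((k : ℤ) + 3) * n + ((k : ℤ) + 1) * R + M < σ * y0) :
    ∀ b : ℤ, min (σT * yBoxLoT n v R k) (σT * yBoxHiT n v R k) ≤ b → b ≤ max (σT * yBoxLoT n v R k) (σT * yBoxHiT n v R k) →
      M < σ * (b + y0) := by
  intro b h1 h2
  have hb := abs_le.1 (clr_yBoxT_range hv R k hσT h1 h2)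
  rw [mul_add]
  rcases hσ with rfl | rfl <;> linarith [hb.1, hb.2]

/-- `U·⌊(nℓ − U + 1)/U⌋ ≥ nℓ − 2U + 2` (the along stride `sLo` of a y′-run in level units). [folklore] -/
theorem clr_mul_sLo_ge {n : ℕ} (hn : 1 ≤ n) (h : ℤ) (ℓ : ℕ) :
    (n : ℤ) * ℓ - 2 * (shearUnit n h : ℤ) + 2 ≤ (shearUnit n h : ℤ) * (((n : ℤ) * ℓ - (shearUnit n h : ℕ) + 1) / (shearUnit n h : ℕ)) := by
  have hU := shearUnit_pos hn h
  have h2 := (RootArith.floor_sandwich (x := (n : ℤ) * ℓ - (shearUnit n h : ℕ) + 1) hU).2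
  linarith

/-- **The level branch of `hclr₃`, pure arithmetic**: with `n ≤ U ≤ 11n`, `ℓ ≥ 22000·Q·(R+2)`, `m ≤ nℓ`, `M + 2 ≤ R`, the origin's level `L ≤ 7m + n`,
`k ≥ 31`, and the three structural bounds `U·s ≥ nℓ − 2U + 2`, `U·q ≤ nℓ + 3U + 1000·Q·R·U`, `U·Lb ≤ 3nℓ + U`:
`U·M + L < U·(k·s − q − k·R − R − Lb)`. [folklore] -/
theorem clr_tan_level_arith {n ℓ U R Q M m L k s q Lb : ℤ} (hn : 1 ≤ n) (hU1 : n ≤ U) (hU2 : U ≤ 11 * n) (hR : 0 ≤ R) (hQ : 1 ≤ Q)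
    (hℓ : 22000 * Q * (R + 2) ≤ ℓ) (hm : m ≤ n * ℓ) (hM : M + 2 ≤ R) (hL : L ≤ 7 * m + n) (hk : 31 ≤ k)
    (hs : n * ℓ - 2 * U + 2 ≤ U * s) (hq : U * q ≤ n * ℓ + 3 * U + 1000 * Q * R * U) (hLb : U * Lb ≤ 3 * (n * ℓ) + U) :
    U * M + L < U * (k * s - q - k * R - R - Lb) := by
  have hk0 : 0 ≤ k := by linarith
  have hU0 : 0 ≤ U := by linarith
  have hn0 : 0 ≤ n := by linarith
  have h1 : k * (n * ℓ - 2 * U + 2) ≤ k * (U * s) := mul_le_mul_of_nonneg_left hs hk0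
  have hUR : U * R ≤ 11 * n * R := mul_le_mul_of_nonneg_right hU2 hR
  have hQR0 : 0 ≤ Q * R := mul_nonneg (by linarith) hR
  have hQRU : Q * R * U ≤ Q * R * (11 * n) := mul_le_mul_of_nonneg_left hU2 hQR0
  have hUM : U * M ≤ U * (R - 2) := mul_le_mul_of_nonneg_left (by linarith) hU0
  have hnℓ : n * (22000 * Q * (R + 2)) ≤ n * ℓ := mul_le_mul_of_nonneg_left hℓ hn0
  have hQn : 1 * n ≤ Q * n := mul_le_mul_of_nonneg_right hQ hn0
  have hnR0 : 0 ≤ n * R := mul_nonneg hn0 hR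
  have hQnR : 1 * (n * R) ≤ Q * (n * R) := mul_le_mul_of_nonneg_right hQ hnR0
  have hQRn0 : 0 ≤ Q * R * n := mul_nonneg hQR0 hn0
  have hQn0 : 0 ≤ Q * n := mul_nonneg (by linarith) hn0
  have hpos : 0 ≤ n * ℓ - 2 * U - U * R + 2 := by nlinarith
  have h31 : 31 * (n * ℓ - 2 * U - U * R + 2) ≤ k * (n * ℓ - 2 * U - U * R + 2) := mul_le_mul_of_nonneg_right hk hpos
  nlinarith

end Arith

/-! ## §2 Reading the origin at the (ζ′) tuple -/

section Origin

variable (κ : Consts) {V : Type} [DecidableEq V] [Countable V] {G : SimpleGraph V} [G.LocallyFinite] (Φ : PlanarSkeletonNeg G) (t : V)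
  (p : unitInterval) (D : DataN V) (g f : ℕ)

/-- The shear unit at the long data: `n_L ≤ U ≤ 11·n_L` (`|h_L| ≤ 10 n_L`). [folklore] -/
theorem clr_shearUnit_bounds (hκ : (hL κ Φ t p D g f).natAbs ≤ 10 * nL κ Φ t p D g f) :
    (nL κ Φ t p D g f : ℤ) ≤ (shearUnit (nL κ Φ t p D g f) (hL κ Φ t p D g f) : ℤ) ∧
      (shearUnit (nL κ Φ t p D g f) (hL κ Φ t p D g f) : ℤ) ≤ 11 * (nL κ Φ t p D g f : ℤ) := by
  unfold Skelφ.shearUnit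
  constructor
  · push_cast; linarith [abs_nonneg (hL κ Φ t p D g f)]
  · have : (((hL κ Φ t p D g f).natAbs : ℕ) : ℤ) ≤ ((10 * nL κ Φ t p D g f : ℕ) : ℤ) := by exact_mod_cast hκ
    push_cast at this ⊢; linarith

/-- **A fine reading controls its functional**: `F = (2uΛ + m)/(2m)` with `|F| ≤ c·u` (`1 ≤ u`, `0 < m`, `0 ≤ c`) gives `|Λ| ≤ (c+1)·m`. [folklore] -/
theorem clr_abs_fun_of_reading {u m Λ F c : ℤ} (hm : 0 < m) (hu : 1 ≤ u) (hc : 0 ≤ c) (hF : F = (2 * u * Λ + m) / (2 * m)) (h : |F| ≤ c * u) :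
    |Λ| ≤ (c + 1) * m := by
  obtain ⟨f1, f2⟩ := RootArith.floor_sandwich (x := 2 * u * Λ + m) (d := 2 * m) (by linarith)
  rw [← hF] at f1 f2
  obtain ⟨hF1, hF2⟩ := abs_le.1 h
  have p1 : 2 * m * F ≤ 2 * m * (c * u) := mul_le_mul_of_nonneg_left hF2 (by linarith)
  have p2 : 2 * m * (-(c * u)) ≤ 2 * m * F := mul_le_mul_of_nonneg_left hF1 (by linarith)
  have p3 : m * 1 ≤ m * u := mul_le_mul_of_nonneg_left hu hm.le
  have hcu : 0 ≤ m * u * c := mul_nonneg (by nlinarith) hc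
  rw [abs_le]
  constructor
  · have key : u * (-((c + 1) * m)) ≤ u * Λ := by nlinarith
    exact le_of_mul_le_mul_left key (by linarith)
  · have key : u * Λ ≤ u * ((c + 1) * m) := by nlinarith
    exact le_of_mul_le_mul_left key (by linarith)

/-- **The ordinate reading controls `Λ₁`**: `|F1cA y| ≤ c·u₁` gives `|Λ₁(y)| ≤ (c+1)·m` (`F1cA = (2u₁Λ₁ + m)/(2m)`). [folklore] -/
theorem clr_abs_Λ₁of_le (hN : EqNumL κ Φ t p D g f) (y : Site 2) {c : ℤ} (hc : 0 ≤ c) (h : |F1cA κ Φ t p D g f y| ≤ c * u₁A κ Φ t p D g f) :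
    |Λ₁of κ Φ t p D g f y| ≤ (c + 1) * modulus (nL κ Φ t p D g f) (hL κ Φ t p D g f) (vL κ Φ t p D g f) (vβL κ Φ t p D g f) := by
  obtain ⟨hn1, hℓ1⟩ := one_le_of_eqNumL κ Φ t p D g f hN
  exact clr_abs_fun_of_reading (Skelφ.NegPrm.modulus_vβOf_pos hn1 hℓ1 _ _) (units_eqA κ Φ t p D g f).2.2.2.2.2.2.2 hc (F1cA_eq κ Φ t p D g f y) h

/-- **The abscissa reading controls `Λ₀`**: `|FcA y| ≤ c·u₀` gives `|Λ₀(y)| ≤ (c+1)·m`. [folklore] -/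
theorem clr_abs_Λ₀of_le (hN : EqNumL κ Φ t p D g f) (y : Site 2) {c : ℤ} (hc : 0 ≤ c) (h : |FcA κ Φ t p D g f y| ≤ c * u₀A κ Φ t p D g f) :
    |Λ₀of κ Φ t p D g f y| ≤ (c + 1) * modulus (nL κ Φ t p D g f) (hL κ Φ t p D g f) (vL κ Φ t p D g f) (vβL κ Φ t p D g f) := by
  obtain ⟨hn1, hℓ1⟩ := one_le_of_eqNumL κ Φ t p D g f hN
  exact clr_abs_fun_of_reading (Skelφ.NegPrm.modulus_vβOf_pos hn1 hℓ1 _ _) (units_eqA κ Φ t p D g f).2.2.2.2.2.2.1 hc (FcA_eq κ Φ t p D g f y) h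

/-- **The abscissa from the two functionals**: `m·y 0 = n_L·Λ₀(y) + v_L·Λ₁(y)`. [folklore] -/
theorem clr_modulus_mul_zero (y : Site 2) :
    modulus (nL κ Φ t p D g f) (hL κ Φ t p D g f) (vL κ Φ t p D g f) (vβL κ Φ t p D g f) * y 0 =
      (nL κ Φ t p D g f : ℤ) * Λ₀of κ Φ t p D g f y + vL κ Φ t p D g f * Λ₁of κ Φ t p D g f y := by
  unfold Λ₀of Λ₁of vβL TwoAxis.Para.modulus; ring

/-- **The cross shift moves `Λ₁` by less than `n_L`**: `|Λ₁(yTX0 yL σT) − Λ₁(yL)| ≤ n_L` (`n_L·⌊σT h_L v_L/n_L⌋ − σT h_L v_L ∈ (−n_L, 0]`). [folklore] -/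
theorem clr_abs_Λ₁of_yTX0_sub (hN : EqNumL κ Φ t p D g f) (yL : Site 2) (σT : ℤ) :
    |Λ₁of κ Φ t p D g f (yTX0 κ Φ t p D g f yL σT) - Λ₁of κ Φ t p D g f yL| ≤ (nL κ Φ t p D g f : ℤ) := by
  obtain ⟨hn1, -⟩ := one_le_of_eqNumL κ Φ t p D g f hN
  have hn0 : (0 : ℤ) < (nL κ Φ t p D g f : ℤ) := by exact_mod_cast hn1
  obtain ⟨f1, f2⟩ := RootArith.floor_sandwich (x := σT * hL κ Φ t p D g f * vL κ Φ t p D g f) hn0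
  unfold Λ₁of yTX0
  simp only [Pi.add_apply, Skelφ.pt_zero, Skelφ.pt_one]
  rw [abs_le]
  constructor
  · nlinarith
  · nlinarith

/-- **The tangential origin's level is the cross-shifted origin's `Λ₁`**: `n_L·yT 1 − h_L·yT 0 = Λ₁(yTX0 yL σT)` for `yT = yL + crossOffX … σ σT Nr`
(the `(Nr+1)` whole strides `(n_L, h_L)` have level `0`). [folklore] -/
theorem clr_lvl_yT_eq (yL : Site 2) (σ σT : ℤ) (Nr : ℕ) :
    (nL κ Φ t p D g f : ℤ) * (yL + crossOffX (nL κ Φ t p D g f) (hL κ Φ t p D g f) (vL κ Φ t p D g f) σ σT Nr) 1 -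
        hL κ Φ t p D g f * (yL + crossOffX (nL κ Φ t p D g f) (hL κ Φ t p D g f) (vL κ Φ t p D g f) σ σT Nr) 0 =
      Λ₁of κ Φ t p D g f (yTX0 κ Φ t p D g f yL σT) := by
  rw [crossOffX_eq]
  unfold Λ₁of
  simp only [Pi.add_apply, Skelφ.pt_zero, Skelφ.pt_one]
  ring

/-- **The tangential origin's level is within `7m + n_L` of the contact's** when `|F1cA yL| ≤ 6u₁`. [folklore] -/
theorem clr_abs_lvl_yT_le (hN : EqNumL κ Φ t p D g f) (yL : Site 2) (he1 : |F1cA κ Φ t p D g f yL| ≤ 6 * u₁A κ Φ t p D g f) (σ σT : ℤ) (Nr : ℕ) :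
    |(nL κ Φ t p D g f : ℤ) * (yL + crossOffX (nL κ Φ t p D g f) (hL κ Φ t p D g f) (vL κ Φ t p D g f) σ σT Nr) 1 -
        hL κ Φ t p D g f * (yL + crossOffX (nL κ Φ t p D g f) (hL κ Φ t p D g f) (vL κ Φ t p D g f) σ σT Nr) 0| ≤
      7 * modulus (nL κ Φ t p D g f) (hL κ Φ t p D g f) (vL κ Φ t p D g f) (vβL κ Φ t p D g f) + (nL κ Φ t p D g f : ℤ) := by
  rw [clr_lvl_yT_eq]
  have h1 := clr_abs_Λ₁of_le κ Φ t p D g f hN yL (by norm_num : (0:ℤ) ≤ 6) he1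
  have h2 := clr_abs_Λ₁of_yTX0_sub κ Φ t p D g f hN yL σT
  have h3 := abs_le.1 h1
  have h4 := abs_le.1 h2
  rw [abs_le]; constructor <;> linarith

/-- **The cross-shifted origin is within `15·n_L` of the contact in abscissa** when `|FcA(yTX0 yL σT)| ≤ 6u₀`, `|F1cA yL| ≤ 6u₁` (and `ℓ_L ≥ 2`).
[folklore] -/
theorem clr_abs_yTX0_zero_le (hN : EqNumL κ Φ t p D g f) (hℓ2 : 2 ≤ ℓL κ Φ t p D g f) (yL : Site 2) (σT : ℤ)
    (he0 : |FcA κ Φ t p D g f (yTX0 κ Φ t p D g f yL σT)| ≤ 6 * u₀A κ Φ t p D g f) (he1 : |F1cA κ Φ t p D g f yL| ≤ 6 * u₁A κ Φ t p D g f) :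
    |yTX0 κ Φ t p D g f yL σT 0| ≤ 15 * (nL κ Φ t p D g f : ℤ) := by
  obtain ⟨hn1, hℓ1⟩ := one_le_of_eqNumL κ Φ t p D g f hN
  have hn0 : (0 : ℤ) < (nL κ Φ t p D g f : ℤ) := by exact_mod_cast hn1
  obtain ⟨hm1, -⟩ := Skelφ.NegPrm.modulus_vβOf hn1 (hL κ Φ t p D g f) (ℓL κ Φ t p D g f) (vL κ Φ t p D g f)
  have e : Skelφ.NegPrm.vβOf (nL κ Φ t p D g f) (hL κ Φ t p D g f) (ℓL κ Φ t p D g f) (vL κ Φ t p D g f) = vβL κ Φ t p D g f := rfl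
  rw [e] at hm1
  have hv := hN.v_le
  have h0 := abs_le.1 (clr_abs_Λ₀of_le κ Φ t p D g f hN (yTX0 κ Φ t p D g f yL σT) (by norm_num : (0:ℤ) ≤ 6) he0)
  have h1 := abs_le.1 (clr_abs_Λ₁of_le κ Φ t p D g f hN yL (by norm_num : (0:ℤ) ≤ 6) he1)
  have h2 := abs_le.1 (clr_abs_Λ₁of_yTX0_sub κ Φ t p D g f hN yL σT)
  have key := clr_modulus_mul_zero κ Φ t p D g f (yTX0 κ Φ t p D g f yL σT)
  set m := modulus (nL κ Φ t p D g f) (hL κ Φ t p D g f) (vL κ Φ t p D g f) (vβL κ Φ t p D g f)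
  set n : ℤ := (nL κ Φ t p D g f : ℤ)
  set v := vL κ Φ t p D g f
  set L0 := Λ₀of κ Φ t p D g f (yTX0 κ Φ t p D g f yL σT)
  set L1 := Λ₁of κ Φ t p D g f (yTX0 κ Φ t p D g f yL σT)
  set y0 := yTX0 κ Φ t p D g f yL σT 0
  have hℓ' : (2 : ℤ) ≤ (ℓL κ Φ t p D g f : ℤ) := by exact_mod_cast hℓ2
  have hnm : n ≤ m := by nlinarith
  have hm0 : 0 < m := by linarith
  have hL1 : |L1| ≤ 8 * m := by rw [abs_le]; constructor <;> linarith [h1.1, h1.2, h2.1, h2.2]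
  have hL0 : |L0| ≤ 7 * m := abs_le.2 ⟨h0.1, h0.2⟩
  have hvL : |v * L1| ≤ n * (8 * m) := by rw [abs_mul]; exact mul_le_mul hv hL1 (abs_nonneg _) hn0.le
  have hnL : |n * L0| ≤ n * (7 * m) := by rw [abs_mul, abs_of_pos hn0]; exact mul_le_mul_of_nonneg_left hL0 hn0.le
  have hsum : |m * y0| ≤ 15 * n * m := by
    rw [key]
    calc |n * L0 + v * L1| ≤ |n * L0| + |v * L1| := abs_add_le _ _
      _ ≤ n * (7 * m) + n * (8 * m) := add_le_add hnL hvL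
      _ = 15 * n * m := by ring
  rw [abs_mul, abs_of_pos hm0] at hsum
  have : m * |y0| ≤ m * (15 * n) := by linarith
  exact le_of_mul_le_mul_left this hm0

end Origin

/-! ## §3 The two G-clr fields at the (ζ′) tuple -/

section Fields

variable (κ : Consts) {V : Type} [DecidableEq V] [Countable V] {G : SimpleGraph V} [G.LocallyFinite] (Φ : PlanarSkeletonNeg G) (t : V)
  (p : unitInterval) (D : DataN V) (mk g f : ℕ)

/-- **THE ALONG COUNT IS AT LEAST `200·Kq − 8`**: the along target is `≥ 5r₀ + 1 − E − 6u₀ = (200·Kq − 6)u₀ + 1 − E` ahead of the cross-shifted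
origin and the run ends within one stride of it (`NrX_spec`). [folklore] -/
theorem clr_NrX_lb (hN : EqNumL κ Φ t p D g f) (x : Site 2) (du : MDir) (hd : du.1 = 0) (z : Site 2) {j E : ℕ} (hj : j < (fcellsA κ Φ t p D g f).K)
    (hlev1 : (fcellsA κ Φ t p D g f).faceL 0 j - E ≤ (fcellsA κ Φ t p D g f).lev du x z)
    (hlev2 : (fcellsA κ Φ t p D g f).lev du x z ≤ (fcellsA κ Φ t p D g f).faceL 0 j + E) (hEu : (E : ℤ) ≤ u₀A κ Φ t p D g f)
    (yL : Site 2) (σT : ℤ) (he0 : |FcA κ Φ t p D g f (yTX0 κ Φ t p D g f yL σT)| ≤ 6 * u₀A κ Φ t p D g f) :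
    200 * (Neg.Kq κ : ℤ) ≤ (NrX κ Φ t p D g f yL σT x du z : ℤ) + 8 := by
  obtain ⟨a1, -⟩ := along_target_bounds κ Φ t p D g f x du hd z hj hlev1 hlev2 yL σT he0
  have hu : 1 ≤ u₀A κ Φ t p D g f := (units_eqA κ Φ t p D g f).2.2.2.2.2.2.1
  obtain ⟨hX, -⟩ := NrX_range κ Φ t p D g f hN x du hd z hj hlev1 hlev2 yL σT he0 (by linarith)
  obtain ⟨hf, -⟩ := NrX_spec κ Φ t p D g f hN yL σT x du z hX
  rw [FcA_crossOffX κ Φ t p D g f hN] at hf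
  have hr : ((fcellsA κ Φ t p D g f).r 0 : ℤ) = 40 * (Neg.Kq κ : ℤ) * u₀A κ Φ t p D g f := (units_eqA κ Φ t p D g f).2.2.1
  have hσ : sgOf du = 1 ∨ sgOf du = -1 := sgOf_sign du
  set u := u₀A κ Φ t p D g f
  set Q : ℤ := (Neg.Kq κ : ℤ)
  set N : ℤ := (NrX κ Φ t p D g f yL σT x du z : ℤ)
  set T := T0X κ Φ t p D g f x du z
  set F := FcA κ Φ t p D g f (yTX0 κ Φ t p D g f yL σT)
  obtain ⟨hf1, hf2⟩ := abs_le.1 hf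
  -- `u·(N+1) ≥ σ·(T − F) − u ≥ 200Qu + 1 − E − 7u ≥ (200Q − 8)u + 1`
  have key : (200 * Q - 8) * u + 1 ≤ u * (N + 1) := by
    rcases hσ with h | h <;> rw [h] at hf1 hf2 a1 <;> nlinarith
  by_contra hc
  push Not at hc
  have h1 : N + 9 - 200 * Q ≤ 0 := by linarith
  have h2 : u * (N + 9 - 200 * Q) ≤ 0 := mul_nonpos_of_nonneg_of_nonpos (by linarith) h1
  nlinarith

/-- **M3 x-face field `hclr`** at the (ζ′) tuple (pinned conclusion; premise block trimmed; ONE added hypothesis `hyL`, the `k = 0` floor of the landing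
origin in RootCases' `hclr_s` shape — served per bridge case by the origins group G-O): the along x-run never dips into the seed box.
[cite: KozmaNitzan2024, §4 Lemma 12 (pp. 23–25)] -/
theorem hclr_XA (hnA : 2000 * Neg.Kq κ * (RA' κ Φ t p D mk + 2) ≤ nL κ Φ t p D g f) (x : Site 2) (du : MDir) (z : Site 2) (yL : Site 2) (qB : ℕ)
    (hyL : ((Mu D : ℕ) : ℤ) < sgOf du * yL 0 - (qB : ℤ) - (RA' κ Φ t p D mk : ℤ) - (nL κ Φ t p D g f : ℤ)) :
    ∀ k ≤ (NrX κ Φ t p D g f yL (σTX κ Φ t p D g f yL x z) x du z), ((Mu D : ℕ) : ℤ) < xBoxLoA (nL κ Φ t p D g f) qB (RA' κ Φ t p D mk) k + sgOf du * yL 0 := by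
  intro k _
  have hRn : RA' κ Φ t p D mk ≤ nL κ Φ t p D g f := by
    have : RA' κ Φ t p D mk ≤ 2000 * Neg.Kq κ * (RA' κ Φ t p D mk + 2) := by have := Neg.one_le_Kq κ; nlinarith
    omega
  exact clr_hclrX_of_zero hRn (by linarith) k

/-- **M3 x-face field `hclr₃`** at the (ζ′) tuple (pinned conclusion; premise block trimmed; NO added hypothesis): every region of the tangential
y′-run is clear of the seed box — by abscissa for `k ≤ 30`, by level for `k ≥ 31`. [cite: KozmaNitzan2024, §4 Lemma 12 (pp. 23–25)]
[cite: MartineauTassion2017, §4.3 Lemma 4.2] -/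
theorem hclr₃_XA (hN : EqNumL κ Φ t p D g f) (hκ : (hL κ Φ t p D g f).natAbs ≤ 10 * nL κ Φ t p D g f)
    (hnA : 2000 * Neg.Kq κ * (RA' κ Φ t p D mk + 2) ≤ nL κ Φ t p D g f) (hℓA : 22000 * Neg.Kq κ * (RA' κ Φ t p D mk + 2) ≤ ℓL κ Φ t p D g f)
    (x : Site 2) (du : MDir) (hd : du.1 = 0) (j : ℕ) (hj : j < (fcellsA κ Φ t p D g f).K) (z : Site 2) {E : ℕ}
    (hlev1 : (fcellsA κ Φ t p D g f).faceL 0 j - E ≤ (fcellsA κ Φ t p D g f).lev du x z) (hlev2 : (fcellsA κ Φ t p D g f).lev du x z ≤ (fcellsA κ Φ t p D g f).faceL 0 j + E)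
    (hEu : (E : ℤ) ≤ u₀A κ Φ t p D g f)
    (yL : Site 2) (he0 : |FcA κ Φ t p D g f (yTX0 κ Φ t p D g f yL (σTX κ Φ t p D g f yL x z))| ≤ 6 * u₀A κ Φ t p D g f)
    (he1 : |F1cA κ Φ t p D g f yL| ≤ 6 * u₁A κ Φ t p D g f) :
    ∀ k ≤ (N3X κ Φ t p D g f yL x z), (∀ b : ℤ, min ((σTX κ Φ t p D g f yL x z) * yBoxLoT (nL κ Φ t p D g f) (prFA κ Φ t p D g f).vα (RA' κ Φ t p D mk) k) ((σTX κ Φ t p D g f yL x z) * yBoxHiT (nL κ Φ t p D g f) (prFA κ Φ t p D g f).vα (RA' κ Φ t p D mk) k) ≤ b → b ≤ max ((σTX κ Φ t p D g f yL x z) * yBoxLoT (nL κ Φ t p D g f) (prFA κ Φ t p D g f).vα (RA' κ Φ t p D mk) k) ((σTX κ Φ t p D g f yL x z) * yBoxHiT (nL κ Φ t p D g f) (prFA κ Φ t p D g f).vα (RA' κ Φ t p D mk) k) → ((Mu D : ℕ) : ℤ) < sgOf du * (b + (yL + crossOffX (nL κ Φ t p D g f) (prFA κ Φ t p D g f).h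 (prFA κ Φ t p D g f).vα (sgOf du) (σTX κ Φ t p D g f yL x z) (NrX κ Φ t p D g f yL (σTX κ Φ t p D g f yL x z) x du z)) 0)) ∨ ((shearUnit (nL κ Φ t p D g f) (prFA κ Φ t p D g f).h : ℤ) * (Mu D) + |(((nL κ Φ t p D g f) : ℕ) : ℤ) * (yL + crossOffX (nL κ Φ t p D g f) (prFA κ Φ t p D g f).h (prFA κ Φ t p D g f).vα (sgOf du) (σTX κ Φ t p D g f yL x z) (NrX κ Φ t p D g f yL (σTX κ Φ t p D g f yL x z) x du z)) 1 - (prFA κ Φ t p D g f).h * (yL + crossOffX (nL κ Φ t p D g f) (prFA κ Φ t p D g f).h (prFA κ Φ t p D g f).vα (sgOf du) (σTX κ Φ t p D g f yL x z) (NrX κ Φ t p D g f yL (σTX κ Φ t p D g f yL x z) x du z)) 0| < (shearUnit (nL κ Φ t p D g f) (prFA κ Φ t p D g f).h : ℤ) * yBoxLoS (nL κ Φ t p D g f) (ℓL κ Φ t p D g f) (prFA κ Φ t p D g f).h (qB3XA κ Φ t p D g f (RA' κ Φ t p D mk)) (RA' κ Φ t p D mk) k) := by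
  have eh : (prFA κ Φ t p D g f).h = hL κ Φ t p D g f := rfl
  have ev : (prFA κ Φ t p D g f).vα = vL κ Φ t p D g f := rfl
  simp only [eh, ev]
  intro k hk
  obtain ⟨hn1, hℓ1⟩ := one_le_of_eqNumL κ Φ t p D g f hN
  have hn0 : (1 : ℤ) ≤ (nL κ Φ t p D g f : ℤ) := by exact_mod_cast hn1
  have hv := hN.v_le
  have hσ : sgOf du = 1 ∨ sgOf du = -1 := sgOf_sign du
  have hσT := (N3X_spec κ Φ t p D g f yL x z).1
  have hq1 : (1 : ℤ) ≤ (Neg.Kq κ : ℤ) := by exact_mod_cast Neg.one_le_Kq κ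
  have hR0 : (0 : ℤ) ≤ (RA' κ Φ t p D mk : ℤ) := Nat.cast_nonneg _
  have hnA' : 2000 * (Neg.Kq κ : ℤ) * ((RA' κ Φ t p D mk : ℤ) + 2) ≤ (nL κ Φ t p D g f : ℤ) := by exact_mod_cast hnA
  have hℓA' : 22000 * (Neg.Kq κ : ℤ) * ((RA' κ Φ t p D mk : ℤ) + 2) ≤ (ℓL κ Φ t p D g f : ℤ) := by exact_mod_cast hℓA
  have hMz : ((Mu D : ℕ) : ℤ) + 2 ≤ (RA' κ Φ t p D mk : ℤ) := by exact_mod_cast Mu_add_two_le_RA' κ Φ t p D mk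
  have hℓ2 : 2 ≤ ℓL κ Φ t p D g f := by
    have : (2 : ℤ) ≤ (ℓL κ Φ t p D g f : ℤ) := by nlinarith
    exact_mod_cast this
  by_cases hk30 : k ≤ 30
  · -- the α-branch: the region's transverse range is far on the `σ` side
    left
    have hNr := clr_NrX_lb κ Φ t p D g f hN x du hd z hj hlev1 hlev2 hEu yL (σTX κ Φ t p D g f yL x z) he0
    have hy0 := abs_le.1 (clr_abs_yTX0_zero_le κ Φ t p D g f hN hℓ2 yL (σTX κ Φ t p D g f yL x z) he0 he1)
    refine clr_tan_alpha_of_room hv (RA' κ Φ t p D mk) k hσ hσT ?_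
    -- `σ·yT 0 = σ·(yTX0 yL σT) 0 + (Nr+1)·n ≥ −15n + (200Q − 7)·n`
    rw [crossOffX_eq, Pi.add_apply, Skelφ.pt_zero]
    set σ := sgOf du
    set N : ℤ := (NrX κ Φ t p D g f yL (σTX κ Φ t p D g f yL x z) x du z : ℤ)
    set n : ℤ := (nL κ Φ t p D g f : ℤ)
    set Y := yTX0 κ Φ t p D g f yL (σTX κ Φ t p D g f yL x z) 0
    have hk' : (k : ℤ) ≤ 30 := by exact_mod_cast hk30
    have hσsq : σ * σ = 1 := by rcases hσ with h | h <;> rw [h] <;> norm_num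
    have e2 : σ * (Y + σ * (N + 1) * n) = σ * Y + (N + 1) * n := by linear_combination ((N + 1) * n) * hσsq
    rw [e2]
    have hσy : -(15 * n) ≤ σ * Y := by
      rcases hσ with h | h <;> rw [h] <;> linarith [hy0.1, hy0.2]
    have hNn : (200 * (Neg.Kq κ : ℤ) - 7) * n ≤ (N + 1) * n := mul_le_mul_of_nonneg_right (by linarith) (by linarith)
    have hkn : ((k : ℤ) + 3) * n ≤ 33 * n := mul_le_mul_of_nonneg_right (by linarith) (by linarith)
    have hkR : ((k : ℤ) + 1) * (RA' κ Φ t p D mk : ℤ) ≤ 31 * (RA' κ Φ t p D mk : ℤ) := mul_le_mul_of_nonneg_right (by linarith) hR0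
    nlinarith
  · -- the level branch: the region sits `≥ 31` level strides above the origin
    right
    push Not at hk30
    have hk31 : (31 : ℤ) ≤ (k : ℤ) := by exact_mod_cast hk30
    obtain ⟨hU1, hU2⟩ := clr_shearUnit_bounds κ Φ t p D g f hκ
    obtain ⟨-, hm2⟩ := Skelφ.NegPrm.modulus_vβOf hn1 (hL κ Φ t p D g f) (ℓL κ Φ t p D g f) (vL κ Φ t p D g f)
    have e : Skelφ.NegPrm.vβOf (nL κ Φ t p D g f) (hL κ Φ t p D g f) (ℓL κ Φ t p D g f) (vL κ Φ t p D g f) = vβL κ Φ t p D g f := rfl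
    rw [e] at hm2
    have hlv := clr_abs_lvl_yT_le κ Φ t p D g f hN yL he1 (sgOf du) (σTX κ Φ t p D g f yL x z) (NrX κ Φ t p D g f yL (σTX κ Φ t p D g f yL x z) x du z)
    have hs := clr_mul_sLo_ge hn1 (hL κ Φ t p D g f) (ℓL κ Φ t p D g f)
    obtain ⟨hW, hLb⟩ := Wrun_spec κ Φ t p D g f hn1
    unfold Lbrun at hLb
    unfold Wrun at hW
    have hq : (shearUnit (nL κ Φ t p D g f) (hL κ Φ t p D g f) : ℤ) * (qB3XA κ Φ t p D g f (RA' κ Φ t p D mk) : ℤ) ≤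
        (nL κ Φ t p D g f : ℤ) * (ℓL κ Φ t p D g f : ℤ) + 3 * (shearUnit (nL κ Φ t p D g f) (hL κ Φ t p D g f) : ℤ) +
          1000 * (Neg.Kq κ : ℤ) * (RA' κ Φ t p D mk : ℤ) * (shearUnit (nL κ Φ t p D g f) (hL κ Φ t p D g f) : ℤ) := by
      have eq : (qB3XA κ Φ t p D g f (RA' κ Φ t p D mk) : ℤ) =
          ((nL κ Φ t p D g f * ℓL κ Φ t p D g f / shearUnit (nL κ Φ t p D g f) (hL κ Φ t p D g f) + 1 : ℕ) : ℤ) +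
            1000 * (Neg.Kq κ : ℤ) * (RA' κ Φ t p D mk : ℤ) + 2 := by
        unfold qB3XA Wrun; push_cast; ring
      rw [eq]
      set U : ℤ := (shearUnit (nL κ Φ t p D g f) (hL κ Φ t p D g f) : ℤ)
      set W : ℤ := ((nL κ Φ t p D g f * ℓL κ Φ t p D g f / shearUnit (nL κ Φ t p D g f) (hL κ Φ t p D g f) + 1 : ℕ) : ℤ)
      have hU0 : 0 ≤ U := by linarith
      have : U * (W + 1000 * (Neg.Kq κ : ℤ) * (RA' κ Φ t p D mk : ℤ) + 2) = U * W + 2 * U + 1000 * (Neg.Kq κ : ℤ) * (RA' κ Φ t p D mk : ℤ) * U := by ring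
      rw [this]
      linarith
    unfold Skelφ.yBoxLoS
    exact clr_tan_level_arith hn0 hU1 hU2 hR0 hq1 hℓA' hm2 hMz hlv hk31 hs hq hLb

end Fields

end KS

end NegB

end PlanarSkeletonNeg

end Summit.CriticalPhenomena.PercolationContinuityZ3.Theorems.Transplant

end
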